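import Summits.Ventures.PercRepro.S1DisjointSumRankTwoParts

/-!
# PercRepro — THE `(6, 2)` AND `(2, 6)` SPLITS AT `(8, 4)`: A RANK-2 PART ON 4 OR 5 POINTS (p2, gen 28;
SUBCLAIM-S1 §6.10 (xvii)(l))

The `(8, 5)` analogues of `S1DisjointSumRankTwoParts`:
* `(6, 2)`: `M` of rank `6` on `9` points, `N = U_{2,4}`: `#U ≤ 4 N_M(6, 3) + 6 N_M(6, 2)`,
  `#Y ≥ 11 f_M(3) + 15 f_M(4) + 16 f_M(5) + 5 f_M(6)`, Theorem M at `(6, 3)` (`Φ = 3`) and Theorem N at `(6, 2)`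
  (`Φ = 13/2`) on `M`: `Φ(8, 4) · #U ≤ 4.68 f_M(3) + 11.43 (f_M(4) + f_M(5))`, term by term;
* `(2, 6)`: `M = U_{2,5}`, `N` of rank `6` on `8` points: `#U ≤ 20 N_N(6, 2)`, `#Y ≥ 26 (f_N(3) + f_N(4) + f_N(5))`,
  Theorem N at `(6, 2)` on `N`: `Φ(8, 4) · #U ≤ 15.6 (…) ≤ 26 (…)`.
Nothing is claimed about any cell.

* `c025_eight_four_disjointSum_six_two`, `c025_eight_four_disjointSum_two_six`.
Axioms: standard.
-/

open scoped Matroid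

namespace PercRepro

namespace S1

open Set

variable {α : Type}

/-- The arithmetic of the `(6, 2)`-split consumer at `(8, 4)`. -/
theorem consumer_arith_six_two {u y P3 P2 f3 f4 f5 f6 : ℚ} (hU : u ≤ 4 * P3 + 6 * P2)
    (h63 : 3 * P3 ≤ f4 + f5) (h62 : 13 / 2 * P2 ≤ f3 + f4 + f5)
    (hY : 11 * f3 + 15 * f4 + 16 * f5 + 5 * f6 ≤ y) (hf3 : 0 ≤ f3) (hf4 : 0 ≤ f4) (hf5 : 0 ≤ f5)
    (hf6 : 0 ≤ f6) : 76 / 15 * u ≤ y := by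
  linarith

/-- **The `(6, 2)`-split consumer at `(8, 4)`**: `M` of rank `6` on `9` points, `N` of rank `2` on `4` points with
all pairs of rank `2`. -/
theorem c025_eight_four_disjointSum_six_two (M N : Matroid α) [M.Finite] [N.Finite] (h : Disjoint M.E N.E)
    (hM : M.eRank = ((6 : ℕ) : ℕ∞)) (hME : M.E.ncard = 9) (hN : N.eRank = ((2 : ℕ) : ℕ∞)) (hNE : N.E.ncard = 4)
    (hpairs : ∀ e ∈ N.E, ∀ f ∈ N.E, e ≠ f → N.eRk {e, f} = 2) :
    phiK 8 4 * ({A : Set α | A ⊆ (M.disjointSum N h).E ∧ (M.disjointSum N h).eRk A = ((8 : ℕ) : ℕ∞) ∧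
        (M.disjointSum N h).eRk ((M.disjointSum N h).E \ A) = ((4 : ℕ) : ℕ∞)}.ncard : ℚ) ≤
      ({A : Set α | A ⊆ (M.disjointSum N h).E ∧ ((4 : ℕ) : ℕ∞) < (M.disjointSum N h).eRk A ∧
        (M.disjointSum N h).eRk A < ((8 : ℕ) : ℕ∞)}.ncard : ℚ) := by
  -- the `U`-side
  have hU : {A : Set α | A ⊆ (M.disjointSum N h).E ∧ (M.disjointSum N h).eRk A = ((8 : ℕ) : ℕ∞) ∧
      (M.disjointSum N h).eRk ((M.disjointSum N h).E \ A) = ((4 : ℕ) : ℕ∞)}.ncard ≤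
      4 * (profileSet M 6 3).ncard + 6 * (profileSet M 6 2).ncard := by
    rw [disjointSum_ncard_U_eq_finsum M N h 8 4, finsum_mem_coe_finset]
    rw [Finset.sum_eq_add_of_mem (6, 3) (6, 2) (by decide) (by decide) (by decide) ?_]
    · dsimp only
      show (profileSet M 6 3).ncard * (profileSet N 2 1).ncard + (profileSet M 6 2).ncard * (profileSet N 2 2).ncard ≤ _
      have h1 := ncard_profileSet_top_one_le_of_pairs' hpairs 2
      rw [hNE] at h1
      have h2 := ncard_profileSet_le_choose_of_ncard_eq (N := N) (a := 2) (b := 2) hNE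
      rw [show Nat.choose (2 + 2) 2 = 6 by decide] at h2
      calc (profileSet M 6 3).ncard * (profileSet N 2 1).ncard + (profileSet M 6 2).ncard * (profileSet N 2 2).ncard
          ≤ (profileSet M 6 3).ncard * 4 + (profileSet M 6 2).ncard * 6 :=
            Nat.add_le_add (Nat.mul_le_mul_left _ h1) (Nat.mul_le_mul_left _ h2)
        _ = 4 * (profileSet M 6 3).ncard + 6 * (profileSet M 6 2).ncard := by ring
    · rintro ⟨a, b⟩ hmem ⟨hne1, hne2⟩
      rw [Finset.mem_product, Finset.mem_range, Finset.mem_range] at hmem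
      dsimp only
      rcases Nat.lt_or_ge 6 a with ha | ha
      · rw [profileSet_eq_empty_of_eRank_lt M hM ha b, ncard_empty, zero_mul]
      rcases Nat.lt_or_ge a 6 with ha' | ha'
      · have h9a : 2 < 8 - a := by omega
        rw [profileSet_eq_empty_of_eRank_lt N hN h9a (4 - b), ncard_empty, mul_zero]
      have ha6 : a = 6 := by omega
      subst ha6
      rw [show (8 : ℕ) - 6 = 2 from rfl]
      rcases Nat.lt_or_ge b 2 with hb | hb
      · have h4 : N.E.ncard < 2 + (4 - b) := by rw [hNE]; omega
        rw [profileSet_eq_empty_of_ncard_lt N h4, ncard_empty, mul_zero]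
      · have hb4 : b = 4 := by
          rcases Nat.lt_or_ge b 4 with hb4 | hb4
          · exfalso
            rcases Nat.lt_or_ge b 3 with hb3 | hb3
            · exact hne2 (by congr 1; omega)
            · exact hne1 (by congr 1; omega)
          · omega
        subst hb4
        rw [profileSet_eq_empty_of_ncard_lt M (by rw [hME]; norm_num : M.E.ncard < 6 + 4), ncard_empty, zero_mul]
  -- the `Y`-side
  have hY : 11 * (rankSet M 3).ncard + 15 * (rankSet M 4).ncard + 16 * (rankSet M 5).ncard +
      5 * (rankSet M 6).ncard ≤
      {A : Set α | A ⊆ (M.disjointSum N h).E ∧ ((4 : ℕ) : ℕ∞) < (M.disjointSum N h).eRk A ∧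
        (M.disjointSum N h).eRk A < ((8 : ℕ) : ℕ∞)}.ncard := by
    rw [disjointSum_ncard_Y_eq_finsum M N h 8 4, finsum_mem_coe_finset]
    have hsub : ({(3, 2), (4, 1), (4, 2), (5, 0), (5, 1), (5, 2), (6, 0), (6, 1)} : Finset (ℕ × ℕ)) ⊆
        (Finset.range 8 ×ˢ Finset.range 8).filter (fun x : ℕ × ℕ => 4 < x.1 + x.2 ∧ x.1 + x.2 < 8) := by
      decide
    refine le_trans ?_ (Finset.sum_le_sum_of_subset hsub)
    rw [Finset.sum_insert (by decide), Finset.sum_insert (by decide), Finset.sum_insert (by decide),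
      Finset.sum_insert (by decide), Finset.sum_insert (by decide), Finset.sum_insert (by decide),
      Finset.sum_insert (by decide), Finset.sum_singleton]
    dsimp only
    have f0 : 1 ≤ (rankSet N 0).ncard := by
      have h0 : (∅ : Set α) ∈ rankSet N 0 := ⟨empty_subset _, by rw [N.eRk_empty]; rfl⟩
      exact (ncard_pos (rankSet_finite N 0)).mpr ⟨∅, h0⟩
    have f1 : 4 ≤ (rankSet N 1).ncard := by
      have := ncard_le_ncard_rankSet_one_of_pairs hpairs (by omega)
      rwa [hNE] at this
    have f2 : 11 ≤ (rankSet N 2).ncard := by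
      have := ncard_rankSet_two_ge_of_rank_two N hN hpairs
      rwa [hNE, show 2 ^ 4 - 1 - 4 = 11 by decide] at this
    have e32 := Nat.mul_le_mul_left (rankSet M 3).ncard f2
    have e41 := Nat.mul_le_mul_left (rankSet M 4).ncard f1
    have e42 := Nat.mul_le_mul_left (rankSet M 4).ncard f2
    have e50 := Nat.mul_le_mul_left (rankSet M 5).ncard f0
    have e51 := Nat.mul_le_mul_left (rankSet M 5).ncard f1
    have e52 := Nat.mul_le_mul_left (rankSet M 5).ncard f2
    have e60 := Nat.mul_le_mul_left (rankSet M 6).ncard f0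
    have e61 := Nat.mul_le_mul_left (rankSet M 6).ncard f1
    linarith
  -- the tree cells of `M`
  have h63 : (3 : ℚ) * ((profileSet M 6 3).ncard : ℚ) ≤ ((rankSet M 4).ncard : ℚ) + ((rankSet M 5).ncard : ℚ) := by
    have h0 := SevenThree.c025_three_all M 6 (by norm_num)
    unfold ThmN.RLS at h0
    rw [phiK_six_three, ySet_eq_rankSet_union_of_eq M (q := 3) (p := 6) (k := 4) (k' := 5) rfl rfl rfl,
      ncard_union_eq (rankSet_disjoint_of_ne M (by norm_num)) (rankSet_finite M 4) (rankSet_finite M 5)] at h0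
    push_cast at h0
    exact h0
  have h62 : (13 / 2 : ℚ) * ((profileSet M 6 2).ncard : ℚ) ≤
      ((rankSet M 3).ncard : ℚ) + ((rankSet M 4).ncard : ℚ) + ((rankSet M 5).ncard : ℚ) := by
    have h0 := ThmN.c025_two_all M 6 (by norm_num)
    unfold ThmN.RLS at h0
    rw [phiK_six_two,
      ySet_eq_rankSet_union3_of_eq M (q := 2) (p := 6) (k := 3) (k' := 4) (k'' := 5) rfl rfl rfl rfl,
      ncard_union_eq (Set.disjoint_union_left.mpr
        ⟨rankSet_disjoint_of_ne M (by norm_num), rankSet_disjoint_of_ne M (by norm_num)⟩)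
        ((rankSet_finite M 3).union (rankSet_finite M 4)) (rankSet_finite M 5),
      ncard_union_eq (rankSet_disjoint_of_ne M (by norm_num)) (rankSet_finite M 3) (rankSet_finite M 4)] at h0
    push_cast at h0
    exact h0
  rw [phiK_eight_four]
  have hU' : (({A : Set α | A ⊆ (M.disjointSum N h).E ∧ (M.disjointSum N h).eRk A = ((8 : ℕ) : ℕ∞) ∧
      (M.disjointSum N h).eRk ((M.disjointSum N h).E \ A) = ((4 : ℕ) : ℕ∞)}.ncard : ℕ) : ℚ) ≤
      4 * ((profileSet M 6 3).ncard : ℚ) + 6 * ((profileSet M 6 2).ncard : ℚ) := by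
    exact_mod_cast hU
  have hY' : 11 * ((rankSet M 3).ncard : ℚ) + 15 * ((rankSet M 4).ncard : ℚ) + 16 * ((rankSet M 5).ncard : ℚ) +
      5 * ((rankSet M 6).ncard : ℚ) ≤
      (({A : Set α | A ⊆ (M.disjointSum N h).E ∧ ((4 : ℕ) : ℕ∞) < (M.disjointSum N h).eRk A ∧
        (M.disjointSum N h).eRk A < ((8 : ℕ) : ℕ∞)}.ncard : ℕ) : ℚ) := by
    exact_mod_cast hY
  exact consumer_arith_six_two hU' h63 h62 hY' (Nat.cast_nonneg _) (Nat.cast_nonneg _) (Nat.cast_nonneg _)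
    (Nat.cast_nonneg _)


/-- The arithmetic of the `(2, 6)`-split consumer at `(8, 4)`. -/
theorem consumer_arith_two_six {u y P2 S : ℚ} (hU : u ≤ 20 * P2) (h62 : 13 / 2 * P2 ≤ S) (hY : 26 * S ≤ y)
    (hS : 0 ≤ S) : 76 / 15 * u ≤ y := by
  linarith

/-- **The `(2, 6)`-split consumer at `(8, 4)`**: `M` of rank `2` on `5` points with all pairs of rank `2`, `N` of
rank `6` on `8` points — from Theorem N at `(6, 2)` on `N` alone. -/
theorem c025_eight_four_disjointSum_two_six (M N : Matroid α) [M.Finite] [N.Finite] (h : Disjoint M.E N.E)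
    (hM : M.eRank = ((2 : ℕ) : ℕ∞)) (hME : M.E.ncard = 5)
    (hpairs : ∀ e ∈ M.E, ∀ f ∈ M.E, e ≠ f → M.eRk {e, f} = 2) (hN : N.eRank = ((6 : ℕ) : ℕ∞))
    (hNE : N.E.ncard = 8) :
    phiK 8 4 * ({A : Set α | A ⊆ (M.disjointSum N h).E ∧ (M.disjointSum N h).eRk A = ((8 : ℕ) : ℕ∞) ∧
        (M.disjointSum N h).eRk ((M.disjointSum N h).E \ A) = ((4 : ℕ) : ℕ∞)}.ncard : ℚ) ≤
      ({A : Set α | A ⊆ (M.disjointSum N h).E ∧ ((4 : ℕ) : ℕ∞) < (M.disjointSum N h).eRk A ∧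
        (M.disjointSum N h).eRk A < ((8 : ℕ) : ℕ∞)}.ncard : ℚ) := by
  -- the `U`-side: only the slice `(2, 2)` survives
  have hU : {A : Set α | A ⊆ (M.disjointSum N h).E ∧ (M.disjointSum N h).eRk A = ((8 : ℕ) : ℕ∞) ∧
      (M.disjointSum N h).eRk ((M.disjointSum N h).E \ A) = ((4 : ℕ) : ℕ∞)}.ncard ≤
      20 * (profileSet N 6 2).ncard := by
    rw [disjointSum_ncard_U_eq_finsum M N h 8 4, finsum_mem_coe_finset]
    rw [Finset.sum_eq_single_of_mem (2, 2) (by decide) ?_]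
    · dsimp only
      show (profileSet M 2 2).ncard * (profileSet N 6 2).ncard ≤ _
      have h22 : (profileSet M 2 2).ncard ≤ 20 := by
        have hsub : profileSet M 2 2 ⊆ {A : Set α | A ⊆ M.E ∧ A.ncard = 2} ∪ {A : Set α | A ⊆ M.E ∧ A.ncard = 3} := by
          rintro A ⟨hAE, hA2, hAc⟩
          have hAfin : A.Finite := M.ground_finite.subset hAE
          have h1 : ((2 : ℕ) : ℕ∞) ≤ (A.ncard : ℕ∞) := by
            rw [← hA2, hAfin.cast_ncard_eq]; exact M.eRk_le_encard A
          have h2 : ((2 : ℕ) : ℕ∞) ≤ ((M.E \ A).ncard : ℕ∞) := by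
            rw [← hAc, (M.ground_finite.subset sdiff_subset).cast_ncard_eq]; exact M.eRk_le_encard _
          have h3 : A.ncard + (M.E \ A).ncard = M.E.ncard := by
            rw [← ncard_union_eq disjoint_sdiff_right hAfin (M.ground_finite.subset sdiff_subset),
              union_sdiff_cancel hAE]
          have h1' : 2 ≤ A.ncard := by exact_mod_cast h1
          have h2' : 2 ≤ (M.E \ A).ncard := by exact_mod_cast h2
          rcases Nat.lt_or_ge A.ncard 3 with h | h
          · left; exact ⟨hAE, by omega⟩
          · right; exact ⟨hAE, by omega⟩
        have hfin : ∀ k : ℕ, {A : Set α | A ⊆ M.E ∧ A.ncard = k}.Finite := fun k =>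
          M.ground_finite.finite_subsets.subset (fun _ hA => hA.1)
        have h := ncard_le_ncard hsub ((hfin 2).union (hfin 3))
        refine h.trans ((ncard_union_le _ _).trans ?_)
        rw [ncard_setOf_subset_ncard_eq M.ground_finite 2, ncard_setOf_subset_ncard_eq M.ground_finite 3, hME]
        decide
      exact Nat.mul_le_mul_right _ h22
    · rintro ⟨a, b⟩ hmem hne
      rw [Finset.mem_product, Finset.mem_range, Finset.mem_range] at hmem
      dsimp only
      rcases Nat.lt_or_ge 2 a with ha | ha
      · rw [profileSet_eq_empty_of_eRank_lt M hM ha b, ncard_empty, zero_mul]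
      rcases Nat.lt_or_ge a 2 with ha' | ha'
      · have h9a : 6 < 8 - a := by omega
        rw [profileSet_eq_empty_of_eRank_lt N hN h9a (4 - b), ncard_empty, mul_zero]
      have ha2 : a = 2 := by omega
      subst ha2
      rw [show (8 : ℕ) - 2 = 6 from rfl]
      rcases Nat.lt_or_ge b 2 with hb | hb
      · have h9 : N.E.ncard < 6 + (4 - b) := by rw [hNE]; omega
        rw [profileSet_eq_empty_of_ncard_lt N h9, ncard_empty, mul_zero]
      · have hb3 : 2 < b := by
          rcases Nat.lt_or_ge b 3 with hb3 | hb3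
          · exfalso; exact hne (by congr 1; omega)
          · omega
        rw [profileSet_eq_empty_of_eRank_lt_snd M hM hb3 2, ncard_empty, zero_mul]
  -- the `Y`-side: the slices `(2, 3) … (2, 6)`
  have hY : 26 * ((rankSet N 3).ncard + (rankSet N 4).ncard + (rankSet N 5).ncard) ≤
      {A : Set α | A ⊆ (M.disjointSum N h).E ∧ ((4 : ℕ) : ℕ∞) < (M.disjointSum N h).eRk A ∧
        (M.disjointSum N h).eRk A < ((8 : ℕ) : ℕ∞)}.ncard := by
    rw [disjointSum_ncard_Y_eq_finsum M N h 8 4, finsum_mem_coe_finset]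
    have hsub : ({(2, 3), (2, 4), (2, 5)} : Finset (ℕ × ℕ)) ⊆
        (Finset.range 8 ×ˢ Finset.range 8).filter (fun x : ℕ × ℕ => 4 < x.1 + x.2 ∧ x.1 + x.2 < 8) := by
      decide
    refine le_trans ?_ (Finset.sum_le_sum_of_subset hsub)
    rw [Finset.sum_insert (by decide), Finset.sum_insert (by decide), Finset.sum_singleton]
    dsimp only
    have f2 : 26 ≤ (rankSet M 2).ncard := by
      have := ncard_rankSet_two_ge_of_rank_two M hM hpairs
      rwa [hME, show 2 ^ 5 - 1 - 5 = 26 by decide] at this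
    have e3 := Nat.mul_le_mul_right (rankSet N 3).ncard f2
    have e4 := Nat.mul_le_mul_right (rankSet N 4).ncard f2
    have e5 := Nat.mul_le_mul_right (rankSet N 5).ncard f2
    linarith
  -- Theorem N at `(6, 2)` on `N`
  have h62 : (13 / 2 : ℚ) * ((profileSet N 6 2).ncard : ℚ) ≤
      ((rankSet N 3).ncard : ℚ) + ((rankSet N 4).ncard : ℚ) + ((rankSet N 5).ncard : ℚ) := by
    have h0 := ThmN.c025_two_all N 6 (by norm_num)
    unfold ThmN.RLS at h0
    rw [phiK_six_two,
      ySet_eq_rankSet_union3_of_eq N (q := 2) (p := 6) (k := 3) (k' := 4) (k'' := 5) rfl rfl rfl rfl,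
      ncard_union_eq (Set.disjoint_union_left.mpr
        ⟨rankSet_disjoint_of_ne N (by norm_num), rankSet_disjoint_of_ne N (by norm_num)⟩)
        ((rankSet_finite N 3).union (rankSet_finite N 4)) (rankSet_finite N 5),
      ncard_union_eq (rankSet_disjoint_of_ne N (by norm_num)) (rankSet_finite N 3) (rankSet_finite N 4)] at h0
    push_cast at h0
    exact h0
  rw [phiK_eight_four]
  have hU' : (({A : Set α | A ⊆ (M.disjointSum N h).E ∧ (M.disjointSum N h).eRk A = ((8 : ℕ) : ℕ∞) ∧
      (M.disjointSum N h).eRk ((M.disjointSum N h).E \ A) = ((4 : ℕ) : ℕ∞)}.ncard : ℕ) : ℚ) ≤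
      20 * ((profileSet N 6 2).ncard : ℚ) := by
    exact_mod_cast hU
  have hY' : 26 * (((rankSet N 3).ncard : ℚ) + ((rankSet N 4).ncard : ℚ) + ((rankSet N 5).ncard : ℚ)) ≤
      (({A : Set α | A ⊆ (M.disjointSum N h).E ∧ ((4 : ℕ) : ℕ∞) < (M.disjointSum N h).eRk A ∧
        (M.disjointSum N h).eRk A < ((8 : ℕ) : ℕ∞)}.ncard : ℕ) : ℚ) := by
    exact_mod_cast hY
  have hS : (0 : ℚ) ≤ ((rankSet N 3).ncard : ℚ) + ((rankSet N 4).ncard : ℚ) + ((rankSet N 5).ncard : ℚ) := by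
    positivity
  exact consumer_arith_two_six hU' h62 hY' hS

end S1

end PercRepro
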